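import Mathlib
import HarnessLib
import Literature.Dynamics.Hyperbolic.RGFlowStableManifoldSecondFixedPointSecondDiff

/-!
# The second fixed point of the fine tuning ([ABKM19] Lemma 12.6), VI: first and mixed second
# DIFFERENCES OF A LAST-SCALE FUNCTIONAL along tuned trajectories
# (the integral `I = ∫ K_N(Λ) dμ_{N+1}^{(q(ℋ))}` of the free-energy representation, difference form)

Continuation of `RGFlowStableManifoldSecondFixedPoint{Lipschitz,SecondDiff}.lean`.  In [ABKM19] Ch. 4
(eqs. (4.7)–(4.12)) the finite-volume free energy of a perturbation `𝒦` is read off from the tuned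
representation `𝒵_N(𝒦) = c · κ(q(ℋ)) · e^{|Λ|λ(ℋ)} · (1 + ∫ K_N(Λ) dμ_{N+1}^{(q(ℋ))})`, `ℋ = ℋ(𝒦)` the tuned
seed (the second fixed point of Lemma 12.6) and `K_N` the final irrelevant coordinate of the tuned
trajectory.  The smoothness half of Theorem 2.2 (`𝒲_N ∈ C²` uniformly in `N`) therefore needs, besides
the regular dependence of `ℋ(𝒦)` and of the trajectory on `𝒦` (parts IV, V), the first and mixed second
differences of the LAST-SCALE FUNCTIONAL `I = Φ(ℋ, K_N)` — a map of the seed `ℋ ∈ E_0` (through the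
Gaussian parameter `q(ℋ)` of the last covariance) and of the final activity `K_N ∈ F_N` (linearly, in the
application).  This file is the corresponding bookkeeping, in the abstract setting of the tree's
`RGFlow` files and in DIFFERENCE FORM (no derivative of `Φ` is used):

* **`RGFlow.norm_lastScale_sub_le`** — two seeds `h₁, h₂` (`‖h₁ − h₂‖ ≤ T`) with final activities
  `y₁, y₂` in the tube (`‖y_i‖_N ≤ εη^N`, `‖y₁ − y₂‖_N ≤ Tη^N`): `‖Φ h₁ y₁ − Φ h₂ y₂‖ ≤ (c_I + l_I ε) T η^N`,
  where `c_I` bounds `Φ(h, ·)`-differences by the activity norm and `l_I` is the Lipschitz constant of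
  `Φ(·, y)` in the seed (per unit of activity norm);
* **`RGFlow.secondDiff_fourPoint_eq`** — the four-point Leibniz identity splitting
  `Σ± Φ(h_{ij}, y_{ij})` into an activity second difference, two mixed products and a seed second
  difference;
* **`RGFlow.norm_quad_secondDiff_seed_le`** — quadrilateral second differences of `Φ(·, y)` over four
  ARBITRARY seeds from parallelogram second differences (`l_II`) and the Lipschitz constant (`l_I`):
  `≤ (l_I ‖Σ± h‖ + l_II ‖h₁₀ − h₀₀‖ ‖h₀₁ − h₀₀‖)·c`;
* **`RGFlow.norm_secondDiff_lastScale_le`** — four seeds `h_{ij}` (`i, j ∈ Bool`) in the `ε`-ball with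
  first differences `T₁` (in `i`), `T₂` (in `j`) and mixed second difference `T₁₂`, final activities with
  the same sizes times `η^N`: `‖Σ± Φ(h_{ij}, y_{ij})‖ ≤ (c_I T₁₂ + 2 l_I' T₁T₂ + (l_I T₁₂ + l_II T₁T₂) ε) η^N`.

The sizes `T`, `T₁`, `T₂`, `T₁₂` are exactly the outputs of `RGFlow.dist_traj_le_of_isTunedQ_initial`
and `RGFlow.secondDiff_initial_le_of_isTunedQ`; the hypotheses on `Φ` are the last-scale instances of
[ABKM19] Lemma 8.4 (`ℓ = 1, 2`: dependence of the Gaussian integration on `q`) and of the bound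
`|∫ K(Λ) dμ_{N+1}| ≤ A⁻¹A_𝒫 ‖K‖_N` ((4.12)).  Everything is proved; no named fact.

## References
* S. Adams, S. Buchholz, R. Kotecký, S. Müller, arXiv:1910.13564, Ch. 4 (4.7)–(4.12), Lemma 8.4,
  Lemma 12.6, Theorem 2.2 [AdamsBuchholzKoteckyMuller2019].
-/

noncomputable section

open Set Function Metric Filter
open scoped NNReal Topology

namespace Literature.Dynamics.Hyperbolic

namespace RGFlow

variable {E : ℕ → Type*} [∀ k, NormedAddCommGroup (E k)] [∀ k, NormedSpace ℝ (E k)]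
  {F : ℕ → Type*} [∀ k, AddCommGroup (F k)]
  {V : Type*} [NormedAddCommGroup V]

/-! ## §15 First differences of a last-scale functional -/

section firstDiff

variable {N : ℕ} {ρ r ε η T cI lI : ℝ} {Q : ∀ k, F k → ℝ → Prop}
  {Φ : E 0 → F N → V} {h₁ h₂ : E 0} {y₁ y₂ : F N}

omit [∀ k, NormedSpace ℝ (E k)] in
/-- **First differences of the last-scale functional along two tuned trajectories** ([ABKM19]
Ch. 4, (4.12) with Lemma 8.4, `ℓ = 1`, difference form): if `Φ(h, ·)`-differences are bounded by `c_I`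
times the activity norm (for activities in the `r`-ball), `Φ(·, y)` is `l_I·‖y‖_N`-Lipschitz in the seed
on the `ρ`-ball, and `(h₁, y₁)`, `(h₂, y₂)` are two (seed, final activity) pairs with `‖h_i‖ ≤ ρ`,
`‖y_i‖_N ≤ εη^N ≤ r`, `‖h₁ − h₂‖ ≤ T`, `‖y₁ − y₂‖_N ≤ Tη^N`, then
`‖Φ h₁ y₁ − Φ h₂ y₂‖ ≤ (c_I + l_I ε)·T·η^N`. [cite: AdamsBuchholzKoteckyMuller2019, Ch. 4 (4.12), Lemma 8.4] -/
theorem norm_lastScale_sub_le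
    (hΦ1 : ∀ h : E 0, ‖h‖ ≤ ρ → ∀ (y y' : F N) (cy cy' c : ℝ), Q N y cy → cy ≤ r → Q N y' cy' →
      cy' ≤ r → Q N (y - y') c → ‖Φ h y - Φ h y'‖ ≤ cI * c)
    (hΦ2 : ∀ h h' : E 0, ‖h‖ ≤ ρ → ‖h'‖ ≤ ρ → ∀ (y : F N) (c : ℝ), Q N y c → c ≤ r →
      ‖Φ h y - Φ h' y‖ ≤ lI * ‖h - h'‖ * c)
    (hlI : 0 ≤ lI) (hεη : 0 ≤ ε * η ^ N) (hεr : ε * η ^ N ≤ r)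
    (hh₁ : ‖h₁‖ ≤ ρ) (hh₂ : ‖h₂‖ ≤ ρ) (hy₁ : Q N y₁ (ε * η ^ N)) (hy₂ : Q N y₂ (ε * η ^ N))
    (hd : ‖h₁ - h₂‖ ≤ T) (hD : Q N (y₁ - y₂) (T * η ^ N)) :
    ‖Φ h₁ y₁ - Φ h₂ y₂‖ ≤ (cI + lI * ε) * T * η ^ N := by
  have e : Φ h₁ y₁ - Φ h₂ y₂ = (Φ h₁ y₁ - Φ h₁ y₂) + (Φ h₁ y₂ - Φ h₂ y₂) := by abel
  have h1 : ‖Φ h₁ y₁ - Φ h₁ y₂‖ ≤ cI * (T * η ^ N) := hΦ1 h₁ hh₁ y₁ y₂ _ _ _ hy₁ hεr hy₂ hεr hD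
  have h2 : ‖Φ h₁ y₂ - Φ h₂ y₂‖ ≤ lI * ‖h₁ - h₂‖ * (ε * η ^ N) := hΦ2 h₁ h₂ hh₁ hh₂ y₂ _ hy₂ hεr
  have h2' : lI * ‖h₁ - h₂‖ * (ε * η ^ N) ≤ lI * T * (ε * η ^ N) :=
    mul_le_mul_of_nonneg_right (mul_le_mul_of_nonneg_left hd hlI) hεη
  rw [e]
  calc ‖(Φ h₁ y₁ - Φ h₁ y₂) + (Φ h₁ y₂ - Φ h₂ y₂)‖
      ≤ ‖Φ h₁ y₁ - Φ h₁ y₂‖ + ‖Φ h₁ y₂ - Φ h₂ y₂‖ := norm_add_le _ _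
    _ ≤ cI * (T * η ^ N) + lI * T * (ε * η ^ N) := add_le_add h1 (h2.trans h2')
    _ = (cI + lI * ε) * T * η ^ N := by ring

end firstDiff

/-! ## §16 The four-point Leibniz identity and quadrilateral second differences in the seed -/

section algebra

variable {N : ℕ} {Φ : E 0 → F N → V}

omit [∀ k, NormedAddCommGroup (E k)] [∀ k, NormedSpace ℝ (E k)] [∀ k, AddCommGroup (F k)] in
/-- **Four-point Leibniz identity**: for four (seed, activity) pairs indexed by `Bool × Bool`,
`Σ± Φ(h_{ij}, y_{ij}) = [Φ(h₁₁,·) second difference in y] + [(Φ(h₁₁,·) − Φ(h₁₀,·)) on y₁₀ − y₀₀]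
+ [(Φ(h₁₁,·) − Φ(h₀₁,·)) on y₀₁ − y₀₀] + [second difference of Φ(·, y₀₀) in the seed]`
(`1 = true`, `0 = false`; valid in any additive group, no linearity assumed).
[cite: AdamsBuchholzKoteckyMuller2019, Ch. 4 (4.12)] -/
theorem secondDiff_fourPoint_eq (h : Bool → Bool → E 0) (y : Bool → Bool → F N) :
    Φ (h true true) (y true true) - Φ (h true false) (y true false)
        - Φ (h false true) (y false true) + Φ (h false false) (y false false)
      = (Φ (h true true) (y true true) - Φ (h true true) (y true false)
            - Φ (h true true) (y false true) + Φ (h true true) (y false false))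
        + ((Φ (h true true) (y true false) - Φ (h true false) (y true false))
            - (Φ (h true true) (y false false) - Φ (h true false) (y false false)))
        + ((Φ (h true true) (y false true) - Φ (h false true) (y false true))
            - (Φ (h true true) (y false false) - Φ (h false true) (y false false)))
        + (Φ (h true true) (y false false) - Φ (h true false) (y false false)
            - Φ (h false true) (y false false) + Φ (h false false) (y false false)) := by
  abel

variable {ρ r ε lI lII : ℝ} {Q : ∀ k, F k → ℝ → Prop}

omit [∀ k, NormedSpace ℝ (E k)] [∀ k, AddCommGroup (F k)] in
/-- **Quadrilateral second differences of `Φ(·, y)` over four arbitrary seeds** from PARALLELOGRAM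
second differences and the Lipschitz constant: if `Φ(·, y)` is `l_I‖y‖_N`-Lipschitz on the `ρ`-ball and
has parallelogram second differences `≤ l_II ‖u‖‖v‖‖y‖_N` there, then for seeds `h_{ij}` with
`‖h_{ij}‖ ≤ ε`, `3ε ≤ ρ`:
`‖Φ(h₁₁,y) − Φ(h₁₀,y) − Φ(h₀₁,y) + Φ(h₀₀,y)‖ ≤ (l_I ‖h₁₁ − h₁₀ − h₀₁ + h₀₀‖ + l_II ‖h₁₀ − h₀₀‖ ‖h₀₁ − h₀₀‖)·c`
(split at the fourth parallelogram vertex `h♯ = h₁₀ + h₀₁ − h₀₀`, `‖h♯‖ ≤ 3ε`).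
[cite: AdamsBuchholzKoteckyMuller2019, Lemma 8.4] -/
theorem norm_quad_secondDiff_seed_le
    (hΦ2 : ∀ h h' : E 0, ‖h‖ ≤ ρ → ‖h'‖ ≤ ρ → ∀ (y : F N) (c : ℝ), Q N y c → c ≤ r →
      ‖Φ h y - Φ h' y‖ ≤ lI * ‖h - h'‖ * c)
    (hΦ22 : ∀ h₀ u v : E 0, ‖h₀‖ ≤ ρ → ‖h₀ + u‖ ≤ ρ → ‖h₀ + v‖ ≤ ρ → ‖h₀ + u + v‖ ≤ ρ →
      ∀ (y : F N) (c : ℝ), Q N y c → c ≤ r →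
        ‖Φ (h₀ + u + v) y - Φ (h₀ + u) y - Φ (h₀ + v) y + Φ h₀ y‖ ≤ lII * ‖u‖ * ‖v‖ * c)
    (hερ : 3 * ε ≤ ρ) {h₁₁ h₁₀ h₀₁ h₀₀ : E 0} (hh₁₁ : ‖h₁₁‖ ≤ ε) (hh₁₀ : ‖h₁₀‖ ≤ ε) (hh₀₁ : ‖h₀₁‖ ≤ ε)
    (hh₀₀ : ‖h₀₀‖ ≤ ε) {y : F N} {c : ℝ} (hy : Q N y c) (hc : c ≤ r) :
    ‖Φ h₁₁ y - Φ h₁₀ y - Φ h₀₁ y + Φ h₀₀ y‖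
      ≤ (lI * ‖h₁₁ - h₁₀ - h₀₁ + h₀₀‖ + lII * ‖h₁₀ - h₀₀‖ * ‖h₀₁ - h₀₀‖) * c := by
  have hε : 0 ≤ ε := (norm_nonneg _).trans hh₀₀
  have hερ' : ε ≤ ρ := by linarith
  -- the fourth parallelogram vertex
  set u := h₁₀ - h₀₀ with hu
  set v := h₀₁ - h₀₀ with hv
  have e1 : h₀₀ + u = h₁₀ := by rw [hu]; abel
  have e2 : h₀₀ + v = h₀₁ := by rw [hv]; abel
  have hsharp : ‖h₀₀ + u + v‖ ≤ ρ := by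
    have e : h₀₀ + u + v = h₁₀ + h₀₁ - h₀₀ := by rw [hu, hv]; abel
    rw [e]
    calc ‖h₁₀ + h₀₁ - h₀₀‖ ≤ ‖h₁₀ + h₀₁‖ + ‖h₀₀‖ := norm_sub_le _ _
      _ ≤ ‖h₁₀‖ + ‖h₀₁‖ + ‖h₀₀‖ := add_le_add (norm_add_le _ _) le_rfl
      _ ≤ ε + ε + ε := by linarith
      _ = 3 * ε := by ring
      _ ≤ ρ := hερ
  have hpar : ‖Φ (h₀₀ + u + v) y - Φ (h₀₀ + u) y - Φ (h₀₀ + v) y + Φ h₀₀ y‖ ≤ lII * ‖u‖ * ‖v‖ * c :=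
    hΦ22 h₀₀ u v (hh₀₀.trans hερ') (by rw [e1]; exact hh₁₀.trans hερ') (by rw [e2]; exact hh₀₁.trans hερ')
      hsharp y c hy hc
  have hlip : ‖Φ h₁₁ y - Φ (h₀₀ + u + v) y‖ ≤ lI * ‖h₁₁ - (h₀₀ + u + v)‖ * c :=
    hΦ2 h₁₁ (h₀₀ + u + v) (hh₁₁.trans hερ') hsharp y c hy hc
  have ew : h₁₁ - (h₀₀ + u + v) = h₁₁ - h₁₀ - h₀₁ + h₀₀ := by rw [hu, hv]; abel
  rw [ew] at hlip
  have e : Φ h₁₁ y - Φ h₁₀ y - Φ h₀₁ y + Φ h₀₀ y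
      = (Φ h₁₁ y - Φ (h₀₀ + u + v) y)
        + (Φ (h₀₀ + u + v) y - Φ (h₀₀ + u) y - Φ (h₀₀ + v) y + Φ h₀₀ y) := by
    rw [e1, e2]; abel
  rw [e]
  calc ‖(Φ h₁₁ y - Φ (h₀₀ + u + v) y)
        + (Φ (h₀₀ + u + v) y - Φ (h₀₀ + u) y - Φ (h₀₀ + v) y + Φ h₀₀ y)‖
      ≤ ‖Φ h₁₁ y - Φ (h₀₀ + u + v) y‖
        + ‖Φ (h₀₀ + u + v) y - Φ (h₀₀ + u) y - Φ (h₀₀ + v) y + Φ h₀₀ y‖ := norm_add_le _ _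
    _ ≤ lI * ‖h₁₁ - h₁₀ - h₀₁ + h₀₀‖ * c + lII * ‖u‖ * ‖v‖ * c := add_le_add hlip hpar
    _ = (lI * ‖h₁₁ - h₁₀ - h₀₁ + h₀₀‖ + lII * ‖u‖ * ‖v‖) * c := by ring

end algebra

/-! ## §17 Mixed second differences of a last-scale functional over four tuned trajectories -/

section secondDiff

variable {N : ℕ} {ρ r ε η T₁ T₂ T₁₂ cI lI lI' lII : ℝ} {Q : ∀ k, F k → ℝ → Prop}
  {Φ : E 0 → F N → V} {h : Bool → Bool → E 0} {y : Bool → Bool → F N}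

omit [∀ k, NormedSpace ℝ (E k)] in
/-- **Mixed second differences of the last-scale functional over four tuned trajectories** ([ABKM19]
Ch. 4 (4.12) with Lemma 8.4, `ℓ ≤ 2`, difference form).  Hypotheses on `Φ` (all for seeds in the
`ρ`-ball and activities in the `r`-ball): four-point `Φ(h,·)`-differences bounded by `c_I` times the
activity norm of `Σ± y` (linearity in the activity); `Φ(·,y)` is `l_I‖y‖_N`-Lipschitz in the seed; the
difference maps `Φ(h,·) − Φ(h',·)` are `l_I'‖h − h'‖`-Lipschitz in the activity norm; parallelogram
second differences of `Φ(·,y)` in the seed are `≤ l_II‖u‖‖v‖‖y‖_N`.  Data: four seeds `h_{ij}` with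
`‖h_{ij}‖ ≤ ε`, `3ε ≤ ρ`, first differences `‖h_{1j} − h_{0j}‖ ≤ T₁`, `‖h_{i1} − h_{i0}‖ ≤ T₂`, mixed second
difference `‖Σ± h‖ ≤ T₁₂`; four final activities with `‖y_{ij}‖_N ≤ εη^N ≤ r` and the same three sizes
times `η^N`.  Then
`‖Σ± Φ(h_{ij}, y_{ij})‖ ≤ (c_I T₁₂ + 2 l_I' T₁ T₂ + (l_I T₁₂ + l_II T₁ T₂) ε) η^N`.
[cite: AdamsBuchholzKoteckyMuller2019, Ch. 4 (4.12), Lemma 8.4, Theorem 2.2] -/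
theorem norm_secondDiff_lastScale_le
    (hΦ4 : ∀ h₀ : E 0, ‖h₀‖ ≤ ρ → ∀ (y₁₁ y₁₀ y₀₁ y₀₀ : F N) (c₁₁ c₁₀ c₀₁ c₀₀ c : ℝ),
      Q N y₁₁ c₁₁ → c₁₁ ≤ r → Q N y₁₀ c₁₀ → c₁₀ ≤ r → Q N y₀₁ c₀₁ → c₀₁ ≤ r → Q N y₀₀ c₀₀ → c₀₀ ≤ r →
      Q N (y₁₁ - y₁₀ - y₀₁ + y₀₀) c →
        ‖Φ h₀ y₁₁ - Φ h₀ y₁₀ - Φ h₀ y₀₁ + Φ h₀ y₀₀‖ ≤ cI * c)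
    (hΦ2 : ∀ h₀ h₀' : E 0, ‖h₀‖ ≤ ρ → ‖h₀'‖ ≤ ρ → ∀ (y₀ : F N) (c : ℝ), Q N y₀ c → c ≤ r →
      ‖Φ h₀ y₀ - Φ h₀' y₀‖ ≤ lI * ‖h₀ - h₀'‖ * c)
    (hΦ12 : ∀ h₀ h₀' : E 0, ‖h₀‖ ≤ ρ → ‖h₀'‖ ≤ ρ → ∀ (y₀ y₀' : F N) (cy cy' c : ℝ), Q N y₀ cy → cy ≤ r →
      Q N y₀' cy' → cy' ≤ r → Q N (y₀ - y₀') c →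
        ‖(Φ h₀ y₀ - Φ h₀' y₀) - (Φ h₀ y₀' - Φ h₀' y₀')‖ ≤ lI' * ‖h₀ - h₀'‖ * c)
    (hΦ22 : ∀ h₀ u v : E 0, ‖h₀‖ ≤ ρ → ‖h₀ + u‖ ≤ ρ → ‖h₀ + v‖ ≤ ρ → ‖h₀ + u + v‖ ≤ ρ →
      ∀ (y₀ : F N) (c : ℝ), Q N y₀ c → c ≤ r →
        ‖Φ (h₀ + u + v) y₀ - Φ (h₀ + u) y₀ - Φ (h₀ + v) y₀ + Φ h₀ y₀‖ ≤ lII * ‖u‖ * ‖v‖ * c)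
    (hlI : 0 ≤ lI) (hlI' : 0 ≤ lI') (hlII : 0 ≤ lII) (hT₁ : 0 ≤ T₁) (hT₂ : 0 ≤ T₂)
    (hη : 0 ≤ η) (hερ : 3 * ε ≤ ρ) (hεr : ε * η ^ N ≤ r)
    (hhε : ∀ i j, ‖h i j‖ ≤ ε) (hyε : ∀ i j, Q N (y i j) (ε * η ^ N))
    (hd₁ : ∀ j, ‖h true j - h false j‖ ≤ T₁) (hd₂ : ∀ i, ‖h i true - h i false‖ ≤ T₂)
    (hd₁₂ : ‖h true true - h true false - h false true + h false false‖ ≤ T₁₂)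
    (hD₁ : ∀ j, Q N (y true j - y false j) (T₁ * η ^ N))
    (hD₂ : ∀ i, Q N (y i true - y i false) (T₂ * η ^ N))
    (hD₁₂ : Q N (y true true - y true false - y false true + y false false) (T₁₂ * η ^ N)) :
    ‖Φ (h true true) (y true true) - Φ (h true false) (y true false)
        - Φ (h false true) (y false true) + Φ (h false false) (y false false)‖
      ≤ (cI * T₁₂ + 2 * lI' * T₁ * T₂ + (lI * T₁₂ + lII * T₁ * T₂) * ε) * η ^ N := by
  have hε : 0 ≤ ε := (norm_nonneg _).trans (hhε false false)
  have hερ' : ε ≤ ρ := by linarith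
  have hhρ : ∀ i j, ‖h i j‖ ≤ ρ := fun i j => (hhε i j).trans hερ'
  have hηN : 0 ≤ η ^ N := pow_nonneg hη N
  have hεη : 0 ≤ ε * η ^ N := mul_nonneg hε hηN
  -- [1] the activity second difference at the seed `h₁₁`
  have h1 : ‖Φ (h true true) (y true true) - Φ (h true true) (y true false)
      - Φ (h true true) (y false true) + Φ (h true true) (y false false)‖ ≤ cI * (T₁₂ * η ^ N) :=
    hΦ4 (h true true) (hhρ true true) _ _ _ _ _ _ _ _ _ (hyε true true) hεr (hyε true false) hεr
      (hyε false true) hεr (hyε false false) hεr hD₁₂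
  -- [2] mixed product: seeds `h₁₁, h₁₀` (differ in `j`), activities `y₁₀ − y₀₀` (differ in `i`)
  have h2 : ‖(Φ (h true true) (y true false) - Φ (h true false) (y true false))
      - (Φ (h true true) (y false false) - Φ (h true false) (y false false))‖ ≤ lI' * T₂ * (T₁ * η ^ N) := by
    have hq := hΦ12 (h true true) (h true false) (hhρ true true) (hhρ true false) (y true false) (y false false)
      _ _ _ (hyε true false) hεr (hyε false false) hεr (hD₁ false)
    refine hq.trans (mul_le_mul_of_nonneg_right (mul_le_mul_of_nonneg_left (hd₂ true) hlI') ?_)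
    exact mul_nonneg hT₁ hηN
  -- [3] mixed product: seeds `h₁₁, h₀₁` (differ in `i`), activities `y₀₁ − y₀₀` (differ in `j`)
  have h3 : ‖(Φ (h true true) (y false true) - Φ (h false true) (y false true))
      - (Φ (h true true) (y false false) - Φ (h false true) (y false false))‖ ≤ lI' * T₁ * (T₂ * η ^ N) := by
    have hq := hΦ12 (h true true) (h false true) (hhρ true true) (hhρ false true) (y false true) (y false false)
      _ _ _ (hyε false true) hεr (hyε false false) hεr (hD₂ false)
    refine hq.trans (mul_le_mul_of_nonneg_right (mul_le_mul_of_nonneg_left (hd₁ true) hlI') ?_)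
    exact mul_nonneg hT₂ hηN
  -- [4] the seed second difference at the activity `y₀₀` (quadrilateral form)
  have h4 : ‖Φ (h true true) (y false false) - Φ (h true false) (y false false)
      - Φ (h false true) (y false false) + Φ (h false false) (y false false)‖
        ≤ (lI * T₁₂ + lII * T₁ * T₂) * (ε * η ^ N) := by
    have hq := norm_quad_secondDiff_seed_le (Φ := Φ) hΦ2 hΦ22 hερ (hhε true true) (hhε true false)
      (hhε false true) (hhε false false) (hyε false false) hεr
    refine hq.trans (mul_le_mul_of_nonneg_right ?_ hεη)
    have ha : lI * ‖h true true - h true false - h false true + h false false‖ ≤ lI * T₁₂ :=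
      mul_le_mul_of_nonneg_left hd₁₂ hlI
    have hb : lII * ‖h true false - h false false‖ * ‖h false true - h false false‖ ≤ lII * T₁ * T₂ := by
      have := mul_le_mul (mul_le_mul_of_nonneg_left (hd₁ false) hlII) (hd₂ false) (norm_nonneg _)
        (mul_nonneg hlII hT₁)
      exact this
    linarith
  rw [secondDiff_fourPoint_eq h y]
  calc _ ≤ ‖Φ (h true true) (y true true) - Φ (h true true) (y true false)
            - Φ (h true true) (y false true) + Φ (h true true) (y false false)‖
        + ‖(Φ (h true true) (y true false) - Φ (h true false) (y true false))
            - (Φ (h true true) (y false false) - Φ (h true false) (y false false))‖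
        + ‖(Φ (h true true) (y false true) - Φ (h false true) (y false true))
            - (Φ (h true true) (y false false) - Φ (h false true) (y false false))‖
        + ‖Φ (h true true) (y false false) - Φ (h true false) (y false false)
            - Φ (h false true) (y false false) + Φ (h false false) (y false false)‖ := by
          refine (norm_add_le _ _).trans (add_le_add ((norm_add_le _ _).trans
            (add_le_add (norm_add_le _ _) le_rfl)) le_rfl)
    _ ≤ cI * (T₁₂ * η ^ N) + lI' * T₂ * (T₁ * η ^ N) + lI' * T₁ * (T₂ * η ^ N)
        + (lI * T₁₂ + lII * T₁ * T₂) * (ε * η ^ N) := by linarith [h1, h2, h3, h4]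
    _ = (cI * T₁₂ + 2 * lI' * T₁ * T₂ + (lI * T₁₂ + lII * T₁ * T₂) * ε) * η ^ N := by ring

end secondDiff

end RGFlow

end Literature.Dynamics.Hyperbolic

end
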